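import Literature.Probability.Percolation.SlabCriticalityInputs
import HarnessLib

/-!
# Static renormalisation of the slab `S_k` by canonical block structures: high-probability
# links between canonical random connected sets force `θ_{S_k}(p) > 0`
# (Newman–Tassion–Wu 2017, proof of Lemma 3.11, the Claim — in abstract form)

Topic: `Literature/Probability/Percolation`. Newman–Tassion–Wu, *Critical percolation and the
minimal spanning tree in slabs* (CPAM 70 (2017); arXiv:1512.09107), prove their finite-size
criterion for percolation in the slab `S_k = ℤ² × {0,…,k}` (Lemma 3.11) through a CLAIM
(p. 14 of the arXiv text): on the rescaled lattice `G = 3nℤ²` declare the coarse edge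
`e = {u, v}` open (`X(e) = 1`) iff a CANONICAL random connected set attached to `u` (there: the
minimal open circuit of the annulus `Ā_{m,n}(u)`) and the one attached to `v` both exist and are
joined by an open path inside a fixed window around `e`; "Since the percolation process `X` is
`1`-dependent, there exists with positive probability an infinite self avoiding path in `G` made of
edges `e` satisfying `X(e) = 1`. This implies that in the slab" the origin percolates with positive
probability. The two mechanisms are (i) the dependent-percolation input (events of far-apart coarse
edges depend on disjoint sets of slab edges; the tree's PROVED
`DuminilCopinSidoraviciusTassion2016_dependentPercolation_holds`, stated for `K`-dependent bond
measures on `ℤ²`) and (ii) CHAINING THROUGH THE CANONICAL SET: two open coarse edges at a common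
coarse vertex `v` use THE SAME random set at `v`, which is connected, so the open paths they
provide lie in one open cluster (this replaces the planar "horizontal and vertical crossings of a
square must meet", unavailable in a slab, and the uniqueness events of Duminil-Copin–Sidoravicius–
Tassion 2016, §2.2, which the tree's `goodEvent` / `…_renormalisation_holds` use).

This file proves the Claim ONCE, in the abstract, for any such block structure (`BlockCore`):
a spacing `N ≥ 1`, a radius `M ≤ N`, and for every planar base point `z` a random set
`core z ω ⊆ \overline{z + B_M}` of slab vertices that is determined by the edges inside
`\overline{z + B_M}` and is `ω`-connected (any two of its vertices are joined by an `ω`-open path).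
The link event of the coarse edge `{x, x + eᵢ}` (base points `z = N·x`, `z' = z + N eᵢ`) is
`link z i = {∃ a ∈ core z, ∃ b ∈ core z', a ⟷ b open inside \overline{z + B_{2N}}}`.

* `NTW17.blockPt`, `NTW17.BlockCore`, `BlockCore.link`, `BlockCore.coarse` (the coarse bond
  configuration on `ℤ²`), `BlockCore.region`; `preimage_slabRelabel_link`,
  `real_link_eq_real_link_zero`, `exists_eta_blockCore_covariant` (translation-covariant cores:
  the two origin links suffice).
* `BlockCore.determinedBy_link`, `isLocalEvent_link`, `measurableSet_link`, `continuous_real_link`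
  (locality, measurability, continuity in `p`); `disjoint_region` (`5`-dependence).
* `BlockCore.exists_reachable_of_coarse_reachable`, `exists_infinite_openCluster_of_coarse` — the
  chaining: an infinite coarse cluster of `0` forces an infinite open cluster meeting `\overline{B_M}`.
* **`NTW17.exists_eta_blockCore`** — THE CLAIM, abstract form: there is a universal `η > 0` such
  that for every thickness `k`, every block structure `B` on `S_k` and every `q ∈ (0,1]`, if every
  link event has `P_q`-probability `> 1 - η`, then `θ_{S_k}(q) > 0` (and `p_c(S_k) ≤ q`,
  `criticalProb_slab_le_of_blockCore`).

What this file does NOT do: choose the cores. For NTW's Lemma 3.11 the core at `z` is the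
vertex set of the minimal open circuit in `Ā_{m,n}(z)` surrounding `z` and the link probability is
bounded below by their Theorem 3.8 (gluing of minimal circuits); that instantiation, and the
circuit vocabulary, are the next files of the RSW3 lane's NTW Layer 2b.

## Sources

* C. M. Newman, V. Tassion, W. Wu, *Critical percolation and the minimal spanning tree in
  slabs*, Comm. Pure Appl. Math. 70 (2017) 2084–2120, arXiv:1512.09107: §3.4, Lemma 3.11 and
  the Claim in its proof with the process `X` on `G = 3nℤ²` (p. 14 of the arXiv text,
  `lit read arxiv:1512.09107` p0014) [NewmanTassionWu2017].
* H. Duminil-Copin, V. Sidoravicius, V. Tassion, *Absence of infinite cluster for critical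
  Bernoulli percolation on slabs*, CPAM 69 (2016), §2.2 (the same renormalisation with
  uniqueness events; the tree's `SlabCriticalityInputs.lean`, whose proof architecture —
  `coarseConfig`, `disjoint_coarseRegion`, `exists_infinite_openCluster_of_coarse`,
  `…_renormalisation_of_dependentPercolation` — this file follows) [DuminilCopinSidoraviciusTassion2016].
* B. Bollobás, O. Riordan, *Percolation*, CUP 2006, Ch. 3, proof of Thm. 10 (p. 75: static
  renormalisation is `1`-independent) [BollobasRiordan2006].

## Design choices

* The window of a link is the box `z + B_{2N}` about the FIRST base point (it contains both
  core boxes since `M ≤ N`); coarse edges at coarse sup-distance `≥ 5` then have disjoint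
  windows, exactly the `5`-separation consumed by `…_dependentPercolation` in the DST port.
* `core_conn` asks for reachability in the open graph of `ω` (not inside a box): this is all the
  chaining uses, and it is implied by any boxed form.
* The hypothesis of the Claim is stated for EVERY coarse edge (`∀ x i`); translation-covariant
  cores reduce it to the two edges at the origin by `real_preimage_slabRelabel` (user side).
* `0 < q` is assumed (at `q = 0` the link events may still hold vacuously when cores overlap;
  NTW work on `[ε, 1 - ε]`).
-/

noncomputable section

namespace Literature.Probability.Percolation

open MeasureTheory LatticeModels SimpleGraph

namespace NTW17

variable (k : ℕ)

/-! ## Block structures -/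

/-- The planar base point `N · x ∈ ℤ²` of the coarse vertex `x ∈ ℤ²` (NTW's rescaled lattice
`G = Nℤ²`, there with `N = 3n`). [cite: NewmanTassionWu2017, §3.4 (proof of Lemma 3.11, the graph G)] -/
def blockPt (N : ℕ) (x : Site 2) : ℤ × ℤ := ((N : ℤ) * x 0, (N : ℤ) * x 1)

/-- `blockPt` of a lattice neighbour: `N · (x + eᵢ) = N · x + N eᵢ` (the edges of `G = Nℤ²`).
[cite: NewmanTassionWu2017, §3.4 (proof of Lemma 3.11, the edge set E of G)] -/
theorem blockPt_add_single (N : ℕ) (x : Site 2) (i : Fin 2) :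
    blockPt N (x + Pi.single i 1) = blockPt N x + coarseShift N i := by
  fin_cases i <;> simp [blockPt, coarseShift, mul_add]

/-- `blockPt N 0 = 0`. [folklore] -/
@[simp] private theorem blockPt_zero (N : ℕ) : blockPt N (0 : Site 2) = 0 := by
  simp [blockPt]

/-- Coordinates of base points dominate the coarse coordinates (`N ≥ 1`). [folklore] -/
private theorem abs_le_abs_blockPt {N : ℕ} (hN : 1 ≤ N) (x : Site 2) :
    |x 0| ≤ |(blockPt N x).1| ∧ |x 1| ≤ |(blockPt N x).2| := by
  simp only [blockPt, abs_mul]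
  have h1 : (1 : ℤ) ≤ |(N : ℤ)| := by
    rw [abs_of_nonneg (by positivity)]; exact_mod_cast hN
  exact ⟨le_mul_of_one_le_left (abs_nonneg _) h1, le_mul_of_one_le_left (abs_nonneg _) h1⟩

/-- **A block structure on the slab `S_k`** (the data of NTW's process `X`, abstract form): a
coarse spacing `N ≥ 1`, a core radius `M ≤ N`, and for every planar base point `z` a random set
`core z ω` of slab vertices inside `\overline{z + B_M}`, determined by the edges inside
`\overline{z + B_M}`, and `ω`-connected. (NTW: `N = 3n`, `core z ω` = the vertices of the minimal
open circuit of `Ā_{m,n}(z)` surrounding `z̄`, `M = n`.)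
[cite: NewmanTassionWu2017, §3.4 (proof of Lemma 3.11, the process X)] -/
structure BlockCore (k : ℕ) where
  /-- the coarse spacing -/
  N : ℕ
  /-- the core radius -/
  M : ℕ
  /-- `N ≥ 1` -/
  one_le_N : 1 ≤ N
  /-- `M ≤ N` -/
  M_le_N : M ≤ N
  /-- the canonical random set attached to the base point `z` -/
  core : ℤ × ℤ → BondConfig (slab 3 k) → Set (slab 3 k)
  /-- the core lives in `\overline{z + B_M}` -/
  core_subset : ∀ z ω, core z ω ⊆ slabLift k (sqBox z M)
  /-- the core is determined by the edges inside `\overline{z + B_M}` -/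
  core_local : ∀ z (ω ω' : BondConfig (slab 3 k)),
    ω ∩ Set.sym2 (slabLift k (sqBox z M)) = ω' ∩ Set.sym2 (slabLift k (sqBox z M)) →
      core z ω = core z ω'
  /-- the core is `ω`-connected -/
  core_conn : ∀ z ω, ∀ a ∈ core z ω, ∀ b ∈ core z ω, (openGraph ω).Reachable a b

namespace BlockCore

variable {k} (B : BlockCore k)

/-- **The link event** of the coarse edge from the base point `z` in direction `i` (NTW's
`X(e) = 1`): some vertex of the core at `z` is joined to some vertex of the core at `z + N eᵢ`
by an open path inside the window `\overline{z + B_{2N}}`.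
[cite: NewmanTassionWu2017, §3.4 (proof of Lemma 3.11, definition of X(e))] -/
def link (z : ℤ × ℤ) (i : Fin 2) : Set (BondConfig (slab 3 k)) :=
  {ω | ∃ a ∈ B.core z ω, ∃ b ∈ B.core (z + coarseShift B.N i) ω,
    ω ∈ openConnIn (slabLift k (sqBox z (2 * B.N))) a b}

/-- The first core box lies in the window. [folklore] -/
private theorem sqBox_subset_window (z : ℤ × ℤ) : sqBox z B.M ⊆ sqBox z (2 * B.N) :=
  sqBox_mono z (by have := B.M_le_N; omega)

/-- The second core box lies in the window. [folklore] -/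
private theorem sqBox_shift_subset_window (z : ℤ × ℤ) (i : Fin 2) :
    sqBox (z + coarseShift B.N i) B.M ⊆ sqBox z (2 * B.N) := by
  intro w hw
  have hMN := B.M_le_N
  simp only [sqBox, Set.mem_setOf_eq, abs_le, coarseShift, Prod.fst_add, Prod.snd_add] at hw ⊢
  fin_cases i <;> simp at hw ⊢ <;> omega

/-- Agreement on the edges inside a lift restricts to sub-boxes. [folklore] -/
private theorem inter_sym2_eq_of_subset {E F : Set (ℤ × ℤ)} (hEF : E ⊆ F) {ω ω' : BondConfig (slab 3 k)}
    (h : ω ∩ Set.sym2 (slabLift k F) = ω' ∩ Set.sym2 (slabLift k F)) :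
    ω ∩ Set.sym2 (slabLift k E) = ω' ∩ Set.sym2 (slabLift k E) := by
  have hsub : Set.sym2 (slabLift k E) ⊆ Set.sym2 (slabLift k F) := sym2_mono (slabLift_mono k hEF)
  calc ω ∩ Set.sym2 (slabLift k E) = (ω ∩ Set.sym2 (slabLift k F)) ∩ Set.sym2 (slabLift k E) := by
        rw [Set.inter_assoc, Set.inter_eq_right.2 hsub]
    _ = (ω' ∩ Set.sym2 (slabLift k F)) ∩ Set.sym2 (slabLift k E) := by rw [h]
    _ = ω' ∩ Set.sym2 (slabLift k E) := by rw [Set.inter_assoc, Set.inter_eq_right.2 hsub]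

/-- **Locality of the link event**: it is determined by the edges inside the window
`\overline{z + B_{2N}}` ("measurable with respect to the edge variables in" the window).
[cite: NewmanTassionWu2017, §3.4 (proof of Lemma 3.11, "X is 1-dependent")] -/
theorem determinedBy_link (z : ℤ × ℤ) (i : Fin 2) :
    DeterminedBy (B.link z i) (Set.sym2 (slabLift k (sqBox z (2 * B.N)))) := by
  rw [determinedBy_iff]
  intro ω ω' h
  have h1 : B.core z ω = B.core z ω' :=
    B.core_local z ω ω' (inter_sym2_eq_of_subset (B.sqBox_subset_window z) h)
  have h2 : B.core (z + coarseShift B.N i) ω = B.core (z + coarseShift B.N i) ω' :=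
    B.core_local _ ω ω' (inter_sym2_eq_of_subset (B.sqBox_shift_subset_window z i) h)
  have h3 : ∀ a b, ω ∈ openConnIn (slabLift k (sqBox z (2 * B.N))) a b ↔
      ω' ∈ openConnIn (slabLift k (sqBox z (2 * B.N))) a b := by
    refine openConnIn_congr fun e he => ?_
    have := Set.ext_iff.1 h e
    simpa [Set.mem_inter_iff, he] using this
  simp only [link, Set.mem_setOf_eq, h1, h2, h3]

/-- The window's edge set is finite. [folklore] -/
private theorem sym2_window_finite (z : ℤ × ℤ) : (Set.sym2 (slabLift k (sqBox z (2 * B.N)))).Finite :=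
  finite_sym2 (slabLift_finite k (sqBox_finite _ _))

/-- The link event is a local event. [cite: NewmanTassionWu2017, §3.4 (proof of Lemma 3.11)] -/
theorem isLocalEvent_link (z : ℤ × ℤ) (i : Fin 2) : IsLocalEvent (B.link z i) :=
  ⟨(B.sym2_window_finite z).toFinset, by
    rw [Set.Finite.coe_toFinset]; exact B.determinedBy_link z i⟩

/-- The link event is measurable. [cite: NewmanTassionWu2017, §3.4 (proof of Lemma 3.11)] -/
theorem measurableSet_link (z : ℤ × ℤ) (i : Fin 2) : MeasurableSet (B.link z i) :=
  measurableSet_of_isLocalEvent_holds (B.isLocalEvent_link z i)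

/-- The link probability is continuous in the parameter (a polynomial in `p`).
[cite: NewmanTassionWu2017, §3.4 (proof of Lemma 3.13: "It is open")] -/
theorem continuous_real_link (z : ℤ × ℤ) (i : Fin 2) :
    Continuous fun q : unitInterval => (bondPercolation (slabGraph 3 k) q).real (B.link z i) :=
  continuous_bondPercolation_real_of_isLocalEvent (slabGraph 3 k) (B.isLocalEvent_link z i)

/-! ## The coarse configuration and the chaining -/

/-- **The coarse bond configuration** (NTW's process `X` on `G ≅ ℤ²`): the nearest-neighbour
edge `{x, x + eᵢ}` of `ℤ²` is open iff the link event of the base point `N·x` in direction `i`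
occurs. [cite: NewmanTassionWu2017, §3.4 (proof of Lemma 3.11, the process X)] -/
def coarse (ω : BondConfig (slab 3 k)) : BondConfig (Site 2) :=
  {e | ∃ (x : Site 2) (i : Fin 2), e = s(x, x + Pi.single i 1) ∧ ω ∈ B.link (blockPt B.N x) i}

/-- Membership of a coarse edge in the coarse configuration. [cite: NewmanTassionWu2017, §3.4 (proof of Lemma 3.11)] -/
theorem mk_mem_coarse_iff (ω : BondConfig (slab 3 k)) (x : Site 2) (i : Fin 2) :
    s(x, x + Pi.single i 1) ∈ B.coarse ω ↔ ω ∈ B.link (blockPt B.N x) i := by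
  constructor
  · rintro ⟨x', j, he, hg⟩
    obtain ⟨rfl, rfl⟩ := (coarseEdge_eq_iff x x' i j).1 he
    exact hg
  · intro h
    exact ⟨x, i, rfl, h⟩

/-- The coarse configuration is a measurable function of the slab configuration.
[cite: NewmanTassionWu2017, §3.4 (proof of Lemma 3.11)] -/
theorem measurable_coarse : Measurable B.coarse := by
  refine measurable_set_iff.2 fun e => ?_
  refine measurableSet_setOf.1 ?_
  have : {ω : BondConfig (slab 3 k) | e ∈ B.coarse ω} =
      ⋃ x : Site 2, ⋃ i : Fin 2, {ω | e = s(x, x + Pi.single i 1) ∧ ω ∈ B.link (blockPt B.N x) i} := by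
    ext ω
    simp only [coarse, Set.mem_setOf_eq, Set.mem_iUnion]
  rw [this]
  refine MeasurableSet.iUnion fun x => MeasurableSet.iUnion fun i => ?_
  by_cases he : e = s(x, x + Pi.single i 1)
  · simp only [he, true_and]
    exact B.measurableSet_link _ i
  · simp only [he, false_and, Set.setOf_false]
    exact MeasurableSet.empty

/-- **Chaining through the cores**: if the coarse vertex `y` is joined to `0` by open coarse
edges, then either `y = 0` or some vertex of the core at `0` is joined by an open path of the
slab to some vertex of the core at `N·y` (two open coarse edges at a common coarse vertex use
the same, connected, core there).
[cite: NewmanTassionWu2017, §3.4 (proof of Lemma 3.11, "This implies that in the slab")] -/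
theorem exists_reachable_of_coarse_reachable {ω : BondConfig (slab 3 k)} {y : Site 2}
    (hy : (openGraph (B.coarse ω)).Reachable 0 y) :
    y = 0 ∨ ∃ a ∈ B.core 0 ω, ∃ b ∈ B.core (blockPt B.N y) ω, (openGraph ω).Reachable a b := by
  rw [SimpleGraph.reachable_iff_reflTransGen] at hy
  induction hy with
  | refl => exact Or.inl rfl
  | @tail b c _ hbc ih =>
    right
    obtain ⟨hmem, -⟩ := (openGraph_adj _ b c).1 hbc
    obtain ⟨x, i, he, hlink⟩ := hmem
    obtain ⟨a₁, ha₁, b₁, hb₁, hconn⟩ := hlink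
    have hr₁ : (openGraph ω).Reachable a₁ b₁ := reachable_of_openConnIn hconn
    rw [← blockPt_add_single] at hb₁
    -- orient the coarse edge: `u ∈ core (blockPt b)`, `v ∈ core (blockPt c)`, `u ~ v`
    obtain ⟨u, hu, v, hv, huv⟩ : ∃ u ∈ B.core (blockPt B.N b) ω, ∃ v ∈ B.core (blockPt B.N c) ω,
        (openGraph ω).Reachable u v := by
      rw [Sym2.eq_iff] at he
      rcases he with ⟨rfl, rfl⟩ | ⟨rfl, rfl⟩
      · exact ⟨a₁, ha₁, b₁, hb₁, hr₁⟩
      · exact ⟨b₁, hb₁, a₁, ha₁, hr₁.symm⟩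
    rcases ih with rfl | ⟨a, ha, b', hb', hab'⟩
    · rw [blockPt_zero] at hu
      exact ⟨u, hu, v, hv, huv⟩
    · exact ⟨a, ha, v, hv, hab'.trans ((B.core_conn _ ω b' hb' u hu).trans huv)⟩

/-- **An infinite coarse cluster of the origin forces an infinite open cluster meeting
`\overline{B_M}`** (NTW: "there exists with positive probability an infinite self avoiding path
in `G` made of edges `e` satisfying `X(e) = 1`. This implies that in the slab" percolation
occurs). [cite: NewmanTassionWu2017, §3.4 (proof of Lemma 3.11, end of the Claim)] -/
theorem exists_infinite_openCluster_of_coarse {ω : BondConfig (slab 3 k)}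
    (hinf : (openCluster (B.coarse ω) (0 : Site 2)).Infinite) :
    ∃ a ∈ slabLift k (sqBox 0 B.M), (openCluster ω a).Infinite := by
  by_contra hcon
  push Not at hcon
  have hX0fin : (slabLift k (sqBox 0 B.M)).Finite := slabLift_finite k (sqBox_finite 0 _)
  have hU : (⋃ a ∈ slabLift k (sqBox 0 B.M), openCluster ω a).Finite :=
    hX0fin.biUnion fun a ha => hcon a ha
  obtain ⟨R, hR⟩ : ∃ R : ℕ, ∀ v ∈ ⋃ a ∈ slabLift k (sqBox 0 B.M), openCluster ω a,
      |(planar k v).1| ≤ R ∧ |(planar k v).2| ≤ R := by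
    have himg := hU.image fun v => max |(planar k v).1| |(planar k v).2|
    obtain ⟨C, hC⟩ := himg.bddAbove
    refine ⟨C.toNat, fun v hv => ?_⟩
    have h := hC (Set.mem_image_of_mem _ hv)
    have h' : max |(planar k v).1| |(planar k v).2| ≤ (C.toNat : ℤ) := h.trans (Int.self_le_toNat C)
    exact ⟨(le_max_left _ _).trans h', (le_max_right _ _).trans h'⟩
  -- a far coarse vertex in the coarse cluster of `0`
  obtain ⟨y, hy, hyF⟩ := hinf.exists_notMem_finset (box 2 (R + B.M))
  have hy0 : y ≠ 0 := by
    rintro rfl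
    apply hyF
    rw [mem_box]
    intro i
    simp only [Pi.zero_apply]
    push_cast
    omega
  rcases B.exists_reachable_of_coarse_reachable hy with h | ⟨a, ha, b, hb, hab⟩
  · exact hy0 h
  have haS : a ∈ slabLift k (sqBox 0 B.M) := B.core_subset 0 ω ha
  have hbU : b ∈ ⋃ a ∈ slabLift k (sqBox 0 B.M), openCluster ω a := Set.mem_biUnion haS hab
  obtain ⟨hb1, hb2⟩ := hR b hbU
  have hyfar : (R : ℤ) + B.M + 1 ≤ |y 0| ∨ (R : ℤ) + B.M + 1 ≤ |y 1| := by
    simp only [mem_box, not_forall] at hyF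
    obtain ⟨j, hj⟩ := hyF
    fin_cases j
    · left; rw [le_abs]; simp at hj; omega
    · right; rw [le_abs]; simp at hj; omega
  have hcp := abs_le_abs_blockPt B.one_le_N y
  have hb := B.core_subset _ ω hb
  simp only [mem_slabLift_iff, sqBox, Set.mem_setOf_eq] at hb
  rw [abs_le] at hb1 hb2
  obtain ⟨hb3, hb4⟩ := hb
  rw [abs_le] at hb3 hb4
  rcases hyfar with h | h
  · have h1 : (R : ℤ) + B.M + 1 ≤ |(blockPt B.N y).1| := h.trans hcp.1
    rw [le_abs] at h1
    omega
  · have h1 : (R : ℤ) + B.M + 1 ≤ |(blockPt B.N y).2| := h.trans hcp.2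
    rw [le_abs] at h1
    omega

/-! ## Dependence structure -/

/-- The slab edges on which the state of the coarse edge `e` depends: for `e = {x, x + eᵢ}` the
edges inside the window `\overline{N·x + B_{2N}}` (none for other pairs).
[cite: NewmanTassionWu2017, §3.4 (proof of Lemma 3.11, "X is 1-dependent")] -/
def region (e : Sym2 (Site 2)) : Set (Sym2 (slab 3 k)) :=
  {d | ∃ (x : Site 2) (i : Fin 2), e = s(x, x + Pi.single i 1) ∧
    d ∈ Set.sym2 (slabLift k (sqBox (blockPt B.N x) (2 * B.N)))}

/-- Events of the coarse configuration determined by the coarse edges of `F` pull back to events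
determined by the slab edges of `⋃_{e ∈ F} region e`. [cite: NewmanTassionWu2017, §3.4 (proof of Lemma 3.11)] -/
theorem determinedBy_preimage_coarse {A : Set (BondConfig (Site 2))} {F : Finset (Sym2 (Site 2))}
    (hA : DeterminedBy A (↑F : Set (Sym2 (Site 2)))) :
    DeterminedBy (B.coarse ⁻¹' A) (⋃ e ∈ F, B.region e) := by
  rw [determinedBy_iff] at hA ⊢
  intro ω ω' h
  have key : ∀ e ∈ F, (e ∈ B.coarse ω ↔ e ∈ B.coarse ω') := by
    intro e he
    simp only [coarse, Set.mem_setOf_eq]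
    refine exists_congr fun x => exists_congr fun i => and_congr_right fun hex => ?_
    refine (determinedBy_iff _ _).1 (B.determinedBy_link (blockPt B.N x) i) ω ω' ?_
    have hsub : Set.sym2 (slabLift k (sqBox (blockPt B.N x) (2 * B.N))) ⊆ ⋃ e ∈ F, B.region e :=
      fun d hd => Set.mem_biUnion (Finset.mem_coe.2 he) ⟨x, i, hex, hd⟩
    calc ω ∩ Set.sym2 (slabLift k (sqBox (blockPt B.N x) (2 * B.N)))
        = (ω ∩ ⋃ e ∈ F, B.region e) ∩ Set.sym2 (slabLift k (sqBox (blockPt B.N x) (2 * B.N))) := by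
          rw [Set.inter_assoc, Set.inter_eq_right.2 hsub]
      _ = (ω' ∩ ⋃ e ∈ F, B.region e) ∩ Set.sym2 (slabLift k (sqBox (blockPt B.N x) (2 * B.N))) := by
          rw [h]
      _ = ω' ∩ Set.sym2 (slabLift k (sqBox (blockPt B.N x) (2 * B.N))) := by
          rw [Set.inter_assoc, Set.inter_eq_right.2 hsub]
  simp only [Set.mem_preimage]
  apply hA
  ext e
  simp only [Set.mem_inter_iff, Finset.mem_coe]
  constructor
  · rintro ⟨h1, h2⟩; exact ⟨(key e h2).1 h1, h2⟩
  · rintro ⟨h1, h2⟩; exact ⟨(key e h2).2 h1, h2⟩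

/-- **`5`-dependence**: coarse edges whose vertices are at sup-distance `≥ 5` depend on disjoint
sets of slab edges (their windows, of radius `2N` about base points `≥ 5N` apart, are disjoint).
[cite: NewmanTassionWu2017, §3.4 (proof of Lemma 3.11, "X is 1-dependent")] -/
theorem disjoint_region {F₁ F₂ : Finset (Sym2 (Site 2))}
    (hfar : ∀ e₁ ∈ F₁, ∀ e₂ ∈ F₂, ∀ a ∈ e₁, ∀ b ∈ e₂, (5 : ℤ) ≤ max |a 0 - b 0| |a 1 - b 1|) :
    Disjoint (⋃ e ∈ F₁, B.region e) (⋃ e ∈ F₂, B.region e) := by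
  have hN := B.one_le_N
  rw [Set.disjoint_left]
  intro d hd1 hd2
  simp only [Set.mem_iUnion, region, Set.mem_setOf_eq, exists_prop] at hd1 hd2
  obtain ⟨e₁, he₁, x₁, i₁, hex₁, hd₁⟩ := hd1
  obtain ⟨e₂, he₂, x₂, i₂, hex₂, hd₂⟩ := hd2
  have h5 := hfar e₁ he₁ e₂ he₂ x₁ (by rw [hex₁]; exact Sym2.mem_mk_left _ _) x₂
    (by rw [hex₂]; exact Sym2.mem_mk_left _ _)
  obtain ⟨v, hv⟩ : ∃ v, v ∈ d := ⟨d.out.1, Sym2.out_fst_mem d⟩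
  have hv₁ : v ∈ slabLift k _ := Set.mem_sym2_iff_subset.1 hd₁ hv
  have hv₂ : v ∈ slabLift k _ := Set.mem_sym2_iff_subset.1 hd₂ hv
  simp only [mem_slabLift_iff, sqBox, Set.mem_setOf_eq, abs_le] at hv₁ hv₂
  have e1 : (blockPt B.N x₁).1 - (blockPt B.N x₂).1 = B.N * (x₁ 0 - x₂ 0) := by
    simp only [blockPt]; ring
  have e2 : (blockPt B.N x₁).2 - (blockPt B.N x₂).2 = B.N * (x₁ 1 - x₂ 1) := by
    simp only [blockPt]; ring
  have hcp : 5 * (B.N : ℤ) ≤ |(blockPt B.N x₁).1 - (blockPt B.N x₂).1| ∨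
      5 * (B.N : ℤ) ≤ |(blockPt B.N x₁).2 - (blockPt B.N x₂).2| := by
    rcases le_max_iff.1 h5 with h | h
    · left
      rw [e1, abs_mul, abs_of_nonneg (by positivity : (0 : ℤ) ≤ B.N)]
      have := mul_le_mul_of_nonneg_left h (show (0 : ℤ) ≤ B.N by positivity)
      linarith
    · right
      rw [e2, abs_mul, abs_of_nonneg (by positivity : (0 : ℤ) ≤ B.N)]
      have := mul_le_mul_of_nonneg_left h (show (0 : ℤ) ≤ B.N by positivity)
      linarith
  rw [le_abs, le_abs] at hcp
  push_cast at hv₁ hv₂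
  omega

end BlockCore

/-! ## The Claim: high-probability links force percolation -/

/-- **NTW 2017, proof of Lemma 3.11, the Claim — abstract form.** There is a universal
`η > 0` such that, for every thickness `k`, every block structure `B` on the slab `S_k` and
every parameter `q > 0`: if EVERY link event of `B` has `P_q`-probability `> 1 - η`, then
`θ_{S_k}(q) > 0`.  Proof: the coarse configuration is a `5`-dependent bond percolation on `ℤ²`
with marginals `> 1 - η` (`disjoint_region`, `bondPercolation_inter_of_disjoint`), so it percolates
from the origin with positive probability (`DuminilCopinSidoraviciusTassion2016_dependentPercolation_holds`);
an infinite coarse cluster forces an infinite open cluster meeting the finite set `\overline{B_M}`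
(`exists_infinite_openCluster_of_coarse`), so `θ_a(q) > 0` for some `a`, whence `θ_0(q) > 0`
(`theta_slabOrigin_pos_of_percolatesAt`).
[cite: NewmanTassionWu2017, §3.4 (proof of Lemma 3.11, the Claim)] -/
theorem exists_eta_blockCore : ∃ η : ℝ, 0 < η ∧ ∀ (k : ℕ) (B : BlockCore k) (q : unitInterval),
    0 < (q : ℝ) →
    (∀ (x : Site 2) (i : Fin 2), 1 - η < (bondPercolation (slabGraph 3 k) q).real (B.link (blockPt B.N x) i)) →
    0 < theta (slabGraph 3 k) (slabOrigin 3 k) q := by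
  obtain ⟨η, hη, hD5⟩ := DuminilCopinSidoraviciusTassion2016_dependentPercolation_holds 5
  refine ⟨η, hη, fun k B q hq0 hgood => ?_⟩
  set P := bondPercolation (slabGraph 3 k) q with hP
  -- the coarse configuration as a dependent bond percolation on `ℤ²`
  set μ := P.map B.coarse with hμ
  haveI : IsProbabilityMeasure μ :=
    Measure.isProbabilityMeasure_map B.measurable_coarse.aemeasurable
  have hdep : ∀ (F₁ F₂ : Finset (Sym2 (Site 2))),
      (∀ e₁ ∈ F₁, ∀ e₂ ∈ F₂, ∀ a ∈ e₁, ∀ b ∈ e₂, ((5 : ℕ) : ℤ) ≤ max |a 0 - b 0| |a 1 - b 1|) →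
      ∀ (A C : Set (BondConfig (Site 2))), DeterminedBy A (↑F₁ : Set (Sym2 (Site 2))) →
        DeterminedBy C (↑F₂ : Set (Sym2 (Site 2))) → MeasurableSet A → MeasurableSet C →
        μ (A ∩ C) = μ A * μ C := by
    intro F₁ F₂ hfar A C hA hC hAm hCm
    rw [hμ, Measure.map_apply B.measurable_coarse (hAm.inter hCm),
      Measure.map_apply B.measurable_coarse hAm, Measure.map_apply B.measurable_coarse hCm,
      Set.preimage_inter]
    exact bondPercolation_inter_of_disjoint (slabGraph 3 k) q
      (B.disjoint_region (by exact_mod_cast hfar))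
      (B.determinedBy_preimage_coarse hA) (B.determinedBy_preimage_coarse hC)
      (hAm.preimage B.measurable_coarse) (hCm.preimage B.measurable_coarse)
  have hmarg : ∀ e ∈ (zdGraph 2).edgeSet, 1 - η ≤ μ.real {ω | e ∈ ω} := by
    intro e he
    have key : ∀ (x : Site 2) (i : Fin 2),
        1 - η ≤ μ.real {ω : BondConfig (Site 2) | s(x, x + Pi.single i 1) ∈ ω} := by
      intro x i
      rw [hμ, map_measureReal_apply B.measurable_coarse (measurableSet_mem _)]
      have hpre : B.coarse ⁻¹' {ω : BondConfig (Site 2) | s(x, x + Pi.single i 1) ∈ ω} =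
          B.link (blockPt B.N x) i := by
        ext ω; exact B.mk_mem_coarse_iff ω x i
      rw [hpre, hP]
      exact (hgood x i).le
    induction e using Sym2.ind with
    | h a b =>
      rw [SimpleGraph.mem_edgeSet] at he
      obtain ⟨i, hab | hab⟩ := (zdGraph_adj_iff a b).1 he
      · rw [hab]; exact key a i
      · rw [hab, Sym2.eq_swap]; exact key b i
  -- percolation of the coarse configuration, transferred to the slab
  have hperc := hD5 μ hdep hmarg
  rw [hμ, map_measureReal_apply B.measurable_coarse (measurableSet_percolatesAt_holds 0)] at hperc
  have hle : P.real (B.coarse ⁻¹' percolatesAt 0) ≤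
      P.real (⋃ a ∈ slabLift k (sqBox 0 B.M), percolatesAt a) := by
    refine measureReal_mono (fun ω hmem => ?_) (measure_ne_top _ _)
    obtain ⟨a, ha, hinf⟩ := B.exists_infinite_openCluster_of_coarse hmem
    exact Set.mem_biUnion ha hinf
  obtain ⟨a, -, hθa⟩ : ∃ a ∈ slabLift k (sqBox 0 B.M), 0 < P.real (percolatesAt a) := by
    by_contra hcon
    push Not at hcon
    have hnull : P (⋃ a ∈ slabLift k (sqBox 0 B.M), percolatesAt a) = 0 := by
      refine (measure_biUnion_null_iff (slabLift_finite k (sqBox_finite 0 _)).countable).2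
        fun a ha => ?_
      have := hcon a ha
      have h0 : P.real (percolatesAt a) = 0 := le_antisymm this measureReal_nonneg
      exact (measureReal_eq_zero_iff (measure_ne_top _ _)).1 h0
    have : P.real (⋃ a ∈ slabLift k (sqBox 0 B.M), percolatesAt a) = 0 := by
      rw [measureReal_def, hnull]; simp
    linarith
  exact theta_slabOrigin_pos_of_percolatesAt k hq0 a hθa

/-- **Corollary: `p_c(S_k) ≤ q`** under the hypotheses of the Claim.
[cite: NewmanTassionWu2017, §3.4 (Lemma 3.11)] -/
theorem criticalProb_slab_le_of_blockCore : ∃ η : ℝ, 0 < η ∧ ∀ (k : ℕ) (B : BlockCore k) (q : unitInterval),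
    0 < (q : ℝ) →
    (∀ (x : Site 2) (i : Fin 2), 1 - η < (bondPercolation (slabGraph 3 k) q).real (B.link (blockPt B.N x) i)) →
    criticalProb (slabGraph 3 k) (slabOrigin 3 k) ≤ (q : ℝ) := by
  obtain ⟨η, hη, h⟩ := exists_eta_blockCore
  exact ⟨η, hη, fun k B q hq hgood =>
    criticalProb_le_of_theta_pos (slabGraph 3 k) (slabOrigin 3 k) q (h k B q hq hgood)⟩

/-! ## Translation-covariant block structures: the two links at the origin suffice -/

namespace BlockCore

variable {k} (B : BlockCore k)

/-- Transport of the link event under a planar translation, for TRANSLATION-COVARIANT cores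
(`core (z + c) (c·ω) = c·(core z ω)`; NTW's minimal circuits are covariant, the tree's
vertex-lexicographic order being invariant under planar translations):
`{ω | c·ω ∈ link (z + c) i} = link z i`. [cite: NewmanTassionWu2017, §3.4 (proof of Lemma 3.11)] -/
theorem preimage_slabRelabel_link
    (hB : ∀ (c z : ℤ × ℤ) (ω : BondConfig (slab 3 k)),
      B.core (z + c) (slabRelabel k (planarShift c) ω) = slabEquiv k (planarShift c) '' B.core z ω)
    (c z : ℤ × ℤ) (i : Fin 2) :
    slabRelabel k (planarShift c) ⁻¹' B.link (z + c) i = B.link z i := by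
  ext ω
  rw [Set.mem_preimage]
  simp only [link, Set.mem_setOf_eq]
  have hz' : z + c + coarseShift B.N i = z + coarseShift B.N i + c := add_right_comm _ _ _
  rw [hz', hB c z ω, hB c (z + coarseShift B.N i) ω, ← image_planarShift_sqBox c z (2 * B.N),
    ← image_slabEquiv_slabLift]
  simp only [Set.exists_mem_image]
  refine exists_congr fun a => and_congr_right fun _ => exists_congr fun b =>
    and_congr_right fun _ => ?_
  exact relabel_mem_openConnIn_iff (slabEquiv k (planarShift c)) ω _ a b

/-- **Translation invariance of the link probability** (covariant cores): every link in
direction `i` has the probability of the origin link in direction `i`.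
[cite: NewmanTassionWu2017, §3.4 (proof of Lemma 3.11)] -/
theorem real_link_eq_real_link_zero
    (hB : ∀ (c z : ℤ × ℤ) (ω : BondConfig (slab 3 k)),
      B.core (z + c) (slabRelabel k (planarShift c) ω) = slabEquiv k (planarShift c) '' B.core z ω)
    (p : unitInterval) (z : ℤ × ℤ) (i : Fin 2) :
    (bondPercolation (slabGraph 3 k) p).real (B.link z i) =
      (bondPercolation (slabGraph 3 k) p).real (B.link 0 i) := by
  rw [← real_preimage_slabRelabel k (planarShift z) (planarAdj_planarShift z) p (B.link z i)]
  congr 1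
  have h := B.preimage_slabRelabel_link hB z 0 i
  rwa [zero_add] at h

end BlockCore

/-- **The Claim for translation-covariant block structures**: with the same universal `η > 0`,
it suffices that the TWO link events at the origin have `P_q`-probability `> 1 - η`.
[cite: NewmanTassionWu2017, §3.4 (proof of Lemma 3.11, the Claim)] -/
theorem exists_eta_blockCore_covariant : ∃ η : ℝ, 0 < η ∧ ∀ (k : ℕ) (B : BlockCore k),
    (∀ (c z : ℤ × ℤ) (ω : BondConfig (slab 3 k)),
      B.core (z + c) (slabRelabel k (planarShift c) ω) = slabEquiv k (planarShift c) '' B.core z ω) →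
    ∀ (q : unitInterval), 0 < (q : ℝ) →
    (∀ i : Fin 2, 1 - η < (bondPercolation (slabGraph 3 k) q).real (B.link 0 i)) →
    0 < theta (slabGraph 3 k) (slabOrigin 3 k) q := by
  obtain ⟨η, hη, h⟩ := exists_eta_blockCore
  refine ⟨η, hη, fun k B hB q hq hgood => h k B q hq fun x i => ?_⟩
  rw [B.real_link_eq_real_link_zero hB]
  exact hgood i

/-- `p_c(S_k) ≤ q` for translation-covariant block structures whose two origin links have
`P_q`-probability `> 1 - η`. [cite: NewmanTassionWu2017, §3.4 (Lemma 3.11)] -/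
theorem criticalProb_slab_le_of_blockCore_covariant : ∃ η : ℝ, 0 < η ∧ ∀ (k : ℕ) (B : BlockCore k),
    (∀ (c z : ℤ × ℤ) (ω : BondConfig (slab 3 k)),
      B.core (z + c) (slabRelabel k (planarShift c) ω) = slabEquiv k (planarShift c) '' B.core z ω) →
    ∀ (q : unitInterval), 0 < (q : ℝ) →
    (∀ i : Fin 2, 1 - η < (bondPercolation (slabGraph 3 k) q).real (B.link 0 i)) →
    criticalProb (slabGraph 3 k) (slabOrigin 3 k) ≤ (q : ℝ) := by
  obtain ⟨η, hη, h⟩ := exists_eta_blockCore_covariant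
  exact ⟨η, hη, fun k B hB q hq hgood =>
    criticalProb_le_of_theta_pos (slabGraph 3 k) (slabOrigin 3 k) q (h k B hB q hq hgood)⟩

end NTW17

end Literature.Probability.Percolation

end
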